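import Mathlib.Analysis.SpecificLimits.Normed
import Literature.Probability.LatticeModels.PlaneRotatorLiebBoxCriterion
import Literature.Probability.LatticeModels.LayeredPlaneRotatorDecoupling
import HarnessLib

/-!
# A certified single-layer susceptibility ceiling from Lieb's box number `S_R`, and layer decoupling
# of the layered XY model with a COMPUTABLE input: `⟨cos(θ_a − θ_c)⟩_Λ ≤ (βJ⊥ X_R(S_R(βJ∥)))^{|ℓ(a) − ℓ(c)|}`

E. H. Lieb, *A refinement of Simon's correlation inequality*, Comm. Math. Phys. **77** (1980) 127–135
[Lieb1980], p. 128: "`φ(β) < 1` for some `β` implies exponential decay" — in the tree, for boxes of radius `R` in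
`ℤ^ν`, `PlaneRotator.twoPoint_nn_le_pow_boxShellSum` (`PlaneRotatorLiebBoxCriterion.lean`):
`⟨cos(θ_a − θ_x)⟩_Λ ≤ S_R^{⌊‖a − x‖_∞/R⌋}` on every finite `Λ ⊂ ℤ^ν`, `S_R = nnBoxShellSum K ν R` Lieb's number.
Summing over `x` (B. Simon, Comm. Math. Phys. **77** (1980) 111 [Simon1980CMP], Thm 1.3: exponential decay ⇒
finite susceptibility) gives, in two dimensions, a SUSCEPTIBILITY CEILING uniform in the volume,

  `∑_{x ∈ Λ} ⟨cos(θ_a − θ_x)⟩_{Λ,K} ≤ X_R(S_R) := (2R − 1)² + 4R(R − 1)·S_R/(1 − S_R) + 8R²·S_R/(1 − S_R)²`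

(`#{y ∈ ℤ² : ⌊‖y‖_∞/R⌋ = k} = 8R²k + 4R² − 4R` for `k ≥ 1`, `(2R−1)²` for `k = 0`, times `S_R^k`, summed) — from
ONE finite-dimensional integral `S_R(K) < 1`. This is exactly the input `χ` of the layer-decoupling theorem
`PlaneRotator.twoPoint_layered_le_pow_interlayer'` (`LayeredPlaneRotatorDecoupling.lean`, cell `pub/hubbard-tc`
INTERLAYER lemma L3): the in-plane system of one layer of the layered XY model on `Λ ⊂ ℤ³` is (dominated by, via
Griffiths–Ginibre) the two-dimensional nearest-neighbour model at `K = βJ∥` on the projected sites. Hence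

* `sum_twoPoint_nn_le_boxSusceptibilityBound` — the 2D susceptibility ceiling above;
* `sum_twoPoint_inPlane_le_boxSusceptibilityBound` — the same for the in-plane system of any layer of `Λ ⊂ ℤ³`;
* **`twoPoint_layered_le_pow_interlayer_box`** — for `β, J∥, J⊥ ≥ 0`, `R ≥ 1` with `S_R(βJ∥) < 1`, every finite
  `Λ ⊂ ℤ³` and `a, c ∈ Λ`: `⟨cos(θ_a − θ_c)⟩_{Λ,β} ≤ (β J⊥ X_R(S_R(βJ∥)))^{|ℓ(a) − ℓ(c)|}`.

Reading (cell `pub/hubbard-tc`, MO-S3, keys K4-c/K5, INTERLAYER §6 L3): `k_B T_c^{3D-XY}(J∥, J⊥) ≤ T` as soon as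
`S_R(J∥/T) < 1` and `J⊥ · X_R(S_R(J∥/T)) < T` for some box radius `R` — the one-sided, theorem-grade form of the
quasi-two-dimensional crossover `T_c^{3D} − T_KT ∼ 1/ln²(J∥/J⊥)` with an input that is a certifiable NUMBER (the 2D
box shell sum), no susceptibility of an infinite system and no Monte-Carlo constant. Classical effective model
only (K5); no `T_c` object; the numerics of `S_R` are not here.
-/

noncomputable section

open MeasureTheory Filter Finset
open scoped Topology BigOperators

namespace Literature.Probability.LatticeModels

namespace PlaneRotator

open Literature.Barriers.CriticalPhenomena Literature.Barriers.CriticalPhenomena.LongRangeIsing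

/-! ### Counting the `R`-rings of `ℤ²` -/

section Rings

variable {ν : ℕ}

omit ν in
/-- `‖x − y‖_∞ = ‖y − x‖_∞` (tree `Site.supNorm`). [folklore] -/
private theorem supNorm_sub_rev {ν : ℕ} (x y : Site ν) : Site.supNorm (x - y) = Site.supNorm (y - x) := by
  rw [← neg_sub, Site.supNorm_neg]

/-- The number of sites of `Λ` in the `k`-th `R`-ring around `a` (`⌊‖x − a‖_∞/R⌋ = k`, `R ≥ 1`) is at most the
number of lattice points `y ∈ [−(R(k+1) − 1), R(k+1) − 1]^ν` with `‖y‖_∞ ≥ Rk` (translate by `−a`).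
[cite: Simon1980CMP, Thm 1.3 (exponential decay summed over the lattice)] -/
theorem card_ring_le {R : ℕ} (hR : 1 ≤ R) (Λ : Finset (Site ν)) (a : Site ν) (k : ℕ) :
    #(Λ.filter fun x => Site.supNorm (x - a) / R = k) ≤
      #((box ν (R * (k + 1) - 1)).filter fun y => R * k ≤ Site.supNorm y) := by
  refine Finset.card_le_card_of_injOn (fun x => x - a) (fun x hx => ?_) fun x _ y _ h => sub_left_injective h
  rw [Finset.mem_coe, Finset.mem_filter] at hx
  obtain ⟨-, hk⟩ := hx
  have h1 : R * k ≤ Site.supNorm (x - a) := by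
    have h := Nat.div_mul_le_self (Site.supNorm (x - a)) R
    rw [hk, mul_comm] at h
    exact h
  have h2 : Site.supNorm (x - a) < R * (k + 1) := by
    have h := Nat.lt_mul_div_succ (Site.supNorm (x - a)) (show 0 < R from hR)
    rwa [hk] at h
  simp only [Finset.coe_filter, Set.mem_setOf_eq, mem_box_iff_supNorm_le]
  exact ⟨by omega, h1⟩

/-- In two dimensions the `k`-th `R`-ring of `ℤ²` (`k ≥ 1`, `R ≥ 1`) has exactly
`(2R(k+1) − 1)² − (2Rk − 1)² = 8R²k + 4R² − 4R` points. [folklore] -/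
private theorem card_ring_two {R : ℕ} (hR : 1 ≤ R) {k : ℕ} (hk : 1 ≤ k) :
    (#((box 2 (R * (k + 1) - 1)).filter fun y => R * k ≤ Site.supNorm y) : ℝ) =
      8 * (R : ℝ) ^ 2 * k + 4 * (R : ℝ) ^ 2 - 4 * R := by
  have hRk : 1 ≤ R * k := Nat.one_le_iff_ne_zero.2 (Nat.mul_ne_zero (by omega) (by omega))
  have hRk1 : R * k ≤ R * (k + 1) := Nat.mul_le_mul_left _ (Nat.le_succ k)
  have hsub : box 2 (R * k - 1) ⊆ box 2 (R * (k + 1) - 1) := box_mono 2 (by omega)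
  have heq : (box 2 (R * (k + 1) - 1)).filter (fun y => R * k ≤ Site.supNorm y) =
      box 2 (R * (k + 1) - 1) \ box 2 (R * k - 1) := by
    ext y
    simp only [Finset.mem_filter, Finset.mem_sdiff, mem_box_iff_supNorm_le]
    constructor
    · rintro ⟨h1, h2⟩; exact ⟨h1, by omega⟩
    · rintro ⟨h1, h2⟩; exact ⟨h1, by omega⟩
  rw [heq, Finset.card_sdiff_of_subset hsub, Nat.cast_sub (Finset.card_le_card hsub), card_box, card_box]
  have e1 : (((R * (k + 1) - 1 : ℕ) : ℝ)) = (R : ℝ) * (k + 1) - 1 := by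
    rw [Nat.cast_sub (hRk.trans hRk1)]; push_cast; ring
  have e2 : (((R * k - 1 : ℕ) : ℝ)) = (R : ℝ) * k - 1 := by
    rw [Nat.cast_sub hRk]; push_cast; ring
  push_cast
  rw [e1, e2]
  ring

/-- The zeroth `R`-ring of `ℤ²` is the box of radius `R − 1`: `(2R − 1)²` points (`R ≥ 1`). [folklore] -/
private theorem card_ring_two_zero {R : ℕ} (hR : 1 ≤ R) :
    (#((box 2 (R * (0 + 1) - 1)).filter fun y => R * 0 ≤ Site.supNorm y) : ℝ) = (2 * (R : ℝ) - 1) ^ 2 := by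
  rw [Nat.mul_zero, Nat.zero_add, Nat.mul_one, Finset.filter_true_of_mem fun y _ => Nat.zero_le _, card_box]
  have e : (((R - 1 : ℕ) : ℝ)) = (R : ℝ) - 1 := by rw [Nat.cast_sub hR]; push_cast; ring
  push_cast
  rw [e]
  ring

/-- Two partial geometric sums: for `0 ≤ s < 1`, `∑_{k<M} s^{k+1} ≤ s/(1−s)` and
`∑_{k<M} (k+1) s^{k+1} ≤ s/(1−s)²`. [folklore] -/
private theorem geometric_partial_sums {s : ℝ} (hs0 : 0 ≤ s) (hs1 : s < 1) (M : ℕ) :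
    ∑ k ∈ Finset.range M, s ^ (k + 1) ≤ s / (1 - s) ∧
      ∑ k ∈ Finset.range M, ((k : ℝ) + 1) * s ^ (k + 1) ≤ s / (1 - s) ^ 2 := by
  constructor
  · have h := sum_le_hasSum (Finset.range M) (fun k _ => mul_nonneg hs0 (pow_nonneg hs0 k))
      ((hasSum_geometric_of_lt_one hs0 hs1).mul_left s)
    calc ∑ k ∈ Finset.range M, s ^ (k + 1) = ∑ k ∈ Finset.range M, s * s ^ k :=
          Finset.sum_congr rfl fun k _ => pow_succ' s k
      _ ≤ s * (1 - s)⁻¹ := h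
      _ = s / (1 - s) := (div_eq_mul_inv _ _).symm
  · have hns : ‖s‖ < 1 := by rw [Real.norm_eq_abs, abs_of_nonneg hs0]; exact hs1
    have h := sum_le_hasSum (Finset.range (M + 1))
      (fun k _ => mul_nonneg (Nat.cast_nonneg k) (pow_nonneg hs0 k))
      (hasSum_coe_mul_geometric_of_norm_lt_one hns)
    rw [Finset.sum_range_succ'] at h
    simp only [Nat.cast_zero, zero_mul, add_zero, Nat.cast_succ] at h
    exact h

/-- **The box susceptibility bound** `X_R(s) = (2R − 1)² + 4R(R − 1)·s/(1 − s) + 8R²·s/(1 − s)²`: the sum of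
`s^{⌊‖y‖_∞/R⌋}` over `y ∈ ℤ²` for `0 ≤ s < 1` (ring `k` has `8R²k + 4R² − 4R` points, ring `0` has `(2R − 1)²`).
[cite: Simon1980CMP, Thm 1.3 (exponential decay summed over the lattice); Lieb1980, p. 128] -/
def boxSusceptibilityBound (R : ℕ) (s : ℝ) : ℝ :=
  (2 * R - 1 : ℝ) ^ 2 + 4 * R * (R - 1) * (s / (1 - s)) + 8 * R ^ 2 * (s / (1 - s) ^ 2)

/-- The lattice sum behind the susceptibility bound: for `R ≥ 1`, `0 ≤ s < 1`, any finite `Λ ⊂ ℤ²` and centre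
`a`, `∑_{x ∈ Λ} s^{⌊‖x − a‖_∞/R⌋} ≤ X_R(s)`. [cite: Simon1980CMP, Thm 1.3 (exponential decay summed over the lattice)] -/
theorem sum_pow_supNorm_div_le {R : ℕ} (hR : 1 ≤ R) {s : ℝ} (hs0 : 0 ≤ s) (hs1 : s < 1)
    (Λ : Finset (Site 2)) (a : Site 2) :
    ∑ x ∈ Λ, s ^ (Site.supNorm (x - a) / R) ≤ boxSusceptibilityBound R s := by
  classical
  -- group the sites of `Λ` by their ring index `k ≤ M`
  set M : ℕ := Λ.sup fun x => Site.supNorm (x - a) / R with hM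
  set fib : ℕ → Finset (Site 2) := fun k => Λ.filter fun x => Site.supNorm (x - a) / R = k with hfib
  have hmaps : ∀ x ∈ Λ, Site.supNorm (x - a) / R ∈ Finset.range (M + 1) := fun x hx =>
    Finset.mem_range.2 (Nat.lt_succ_of_le (Finset.le_sup (f := fun x => Site.supNorm (x - a) / R) hx))
  have hgroup : ∑ x ∈ Λ, s ^ (Site.supNorm (x - a) / R) = ∑ k ∈ Finset.range (M + 1), (#(fib k) : ℝ) * s ^ k := by
    rw [← Finset.sum_fiberwise_of_maps_to hmaps]
    refine Finset.sum_congr rfl fun k _ => ?_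
    rw [Finset.sum_congr rfl fun x hx => by rw [(Finset.mem_filter.1 hx).2], Finset.sum_const, nsmul_eq_mul]
  rw [hgroup, Finset.sum_range_succ']
  -- ring `0` and rings `k + 1`
  have h0 : (#(fib 0) : ℝ) * s ^ 0 ≤ (2 * (R : ℝ) - 1) ^ 2 := by
    rw [pow_zero, mul_one, ← card_ring_two_zero hR]
    exact_mod_cast card_ring_le hR Λ a 0
  have hk : ∀ k ∈ Finset.range M, (#(fib (k + 1)) : ℝ) * s ^ (k + 1) ≤
      (8 * (R : ℝ) ^ 2 * ((k : ℝ) + 1) + (4 * (R : ℝ) ^ 2 - 4 * R)) * s ^ (k + 1) := by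
    intro k _
    refine mul_le_mul_of_nonneg_right ?_ (pow_nonneg hs0 _)
    have h := card_ring_le hR Λ a (k + 1)
    have h' : (#(fib (k + 1)) : ℝ) ≤ #((box 2 (R * (k + 1 + 1) - 1)).filter fun y => R * (k + 1) ≤ Site.supNorm y) := by
      exact_mod_cast h
    rw [card_ring_two hR (Nat.le_add_left 1 k)] at h'
    push_cast at h'
    linarith
  obtain ⟨hg1, hg2⟩ := geometric_partial_sums hs0 hs1 M
  have hsplit : ∑ k ∈ Finset.range M, (8 * (R : ℝ) ^ 2 * ((k : ℝ) + 1) + (4 * (R : ℝ) ^ 2 - 4 * R)) * s ^ (k + 1)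
      = 8 * (R : ℝ) ^ 2 * ∑ k ∈ Finset.range M, ((k : ℝ) + 1) * s ^ (k + 1) +
        (4 * (R : ℝ) ^ 2 - 4 * R) * ∑ k ∈ Finset.range M, s ^ (k + 1) := by
    rw [Finset.mul_sum, Finset.mul_sum, ← Finset.sum_add_distrib]
    exact Finset.sum_congr rfl fun k _ => by ring
  have hR1 : (1 : ℝ) ≤ R := by exact_mod_cast hR
  have hc : 0 ≤ 4 * (R : ℝ) ^ 2 - 4 * R := by nlinarith
  calc ∑ k ∈ Finset.range M, (#(fib (k + 1)) : ℝ) * s ^ (k + 1) + (#(fib 0) : ℝ) * s ^ 0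
      ≤ ∑ k ∈ Finset.range M, (8 * (R : ℝ) ^ 2 * ((k : ℝ) + 1) + (4 * (R : ℝ) ^ 2 - 4 * R)) * s ^ (k + 1)
          + (2 * (R : ℝ) - 1) ^ 2 := add_le_add (Finset.sum_le_sum hk) h0
    _ = 8 * (R : ℝ) ^ 2 * ∑ k ∈ Finset.range M, ((k : ℝ) + 1) * s ^ (k + 1) +
        (4 * (R : ℝ) ^ 2 - 4 * R) * ∑ k ∈ Finset.range M, s ^ (k + 1) + (2 * (R : ℝ) - 1) ^ 2 := by rw [hsplit]
    _ ≤ 8 * (R : ℝ) ^ 2 * (s / (1 - s) ^ 2) + (4 * (R : ℝ) ^ 2 - 4 * R) * (s / (1 - s)) + (2 * (R : ℝ) - 1) ^ 2 := by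
        gcongr
    _ = boxSusceptibilityBound R s := by unfold boxSusceptibilityBound; ring

end Rings

/-! ### The two-dimensional susceptibility ceiling from `S_R < 1` -/

section Susceptibility

variable [MeasurableSpace Circle] [BorelSpace Circle]

/-- **Single-layer susceptibility ceiling from Lieb's box number.** For `K ≥ 0`, `R ≥ 1` with
`S_R(K) = nnBoxShellSum K 2 R < 1`, every finite `Λ ⊂ ℤ²` (free boundary conditions) and `a ∈ Λ`:
`∑_{x ∈ Λ} ⟨cos(θ_a − θ_x)⟩_{Λ,K} ≤ X_R(S_R(K))` — a bound on the two-dimensional susceptibility uniform in the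
volume, from ONE finite-dimensional integral (Lieb's box criterion summed over the lattice, Simon's Thm 1.3).
[cite: Lieb1980, p. 128 (φ(β) < 1 ⇒ exponential decay); Simon1980CMP, Thm 1.3] -/
theorem sum_twoPoint_nn_le_boxSusceptibilityBound {K : ℝ} (hK : 0 ≤ K) {R : ℕ} (hR : 1 ≤ R)
    (hS : nnBoxShellSum K 2 R < 1) (Λ : Finset (Site 2)) (a : Λ) :
    ∑ x : Λ, twoPoint (nnXYCoupling K 2 Λ) a x ≤ boxSusceptibilityBound R (nnBoxShellSum K 2 R) := by
  have hS0 : 0 ≤ nnBoxShellSum K 2 R :=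
    boxShellSum_nonneg (fun x y => mul_nonneg (by positivity) (nnCoupling_nonneg _ _)) R
  calc ∑ x : Λ, twoPoint (nnXYCoupling K 2 Λ) a x
      ≤ ∑ x : Λ, nnBoxShellSum K 2 R ^ (Site.supNorm ((x : Site 2) - (a : Site 2)) / R) := by
        refine Finset.sum_le_sum fun x _ => ?_
        rw [supNorm_sub_rev]
        exact twoPoint_nn_le_pow_boxShellSum hK hR Λ a x
    _ = ∑ x ∈ Λ, nnBoxShellSum K 2 R ^ (Site.supNorm (x - (a : Site 2)) / R) :=
        Finset.sum_coe_sort Λ (fun x => nnBoxShellSum K 2 R ^ (Site.supNorm (x - (a : Site 2)) / R))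
    _ ≤ boxSusceptibilityBound R (nnBoxShellSum K 2 R) := sum_pow_supNorm_div_le hR hS0 hS Λ a

end Susceptibility

/-! ### The in-plane system of a layer is dominated by the two-dimensional model -/

section Layers

variable [MeasurableSpace Circle] [BorelSpace Circle]

/-- The projection `ℤ³ → ℤ²` onto the in-plane coordinates. [cite: LiuStanley1972, p. 272 (layers (J, J, εJ))] -/
def planeProj (y : Site 3) : Site 2 := ![y 0, y 1]

omit [MeasurableSpace Circle] [BorelSpace Circle] in
/-- For two sites in the same layer, the `ℓ¹` distance is the in-plane `ℓ¹` distance. [folklore] -/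
private theorem l1Norm_sub_eq_of_layer_eq {y z : Site 3} (h : y 2 = z 2) :
    l1Norm (y - z) = l1Norm (planeProj y - planeProj z) := by
  unfold l1Norm planeProj
  rw [Fin.sum_univ_three, Fin.sum_univ_two]
  simp [h]

omit [MeasurableSpace Circle] [BorelSpace Circle] in
/-- The projection is injective on each layer. [folklore] -/
private theorem planeProj_injOn_layer {y z : Site 3} (h : y 2 = z 2) (hp : planeProj y = planeProj z) : y = z := by
  have h0 : y 0 = z 0 := by simpa [planeProj] using congrFun hp 0
  have h1 : y 1 = z 1 := by simpa [planeProj] using congrFun hp 1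
  funext i
  fin_cases i
  · exact h0
  · exact h1
  · exact h

/-- **The in-plane system of a layer is dominated by the two-dimensional model.** For the layered XY model on a
finite `Λ ⊂ ℤ³` and a site `a`, the single-layer susceptibility of the in-plane system of the layer of `a` is at
most the box susceptibility bound of the two-dimensional nearest-neighbour model at `K = βJ∥`:
`∑_{x ∈ Λ_{ℓ(a)}} ⟨cos(θ_a − θ_x)⟩^{2D}_{Λ_{ℓ(a)}} ≤ X_R(S_R(βJ∥))` whenever `S_R(βJ∥) < 1` (Griffiths–Ginibre comparison
with the 2D model on the projected sites, then `sum_twoPoint_nn_le_boxSusceptibilityBound`).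
[cite: Lieb1980, p. 128 (φ(β) < 1 ⇒ exponential decay); Ginibre1970, Prop. 3 with Example 4 (plane rotators)] -/
theorem sum_twoPoint_inPlane_le_boxSusceptibilityBound {β Jp Jz : ℝ} (hβ : 0 ≤ β) (hp : 0 ≤ Jp) (hz : 0 ≤ Jz)
    {R : ℕ} (hR : 1 ≤ R) (hS : nnBoxShellSum (β * Jp) 2 R < 1) (Λ : Finset (Site 3)) (a : Λ) :
    ∑ x ∈ univ.filter (fun x : Λ => layer x = layer a),
      twoPoint (inPlane (layeredXYCoupling β Jp Jz Λ) (layer a)) a x ≤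
        boxSusceptibilityBound R (nnBoxShellSum (β * Jp) 2 R) := by
  classical
  -- the projected sites and the comparison map
  set Λ₂ : Finset (Site 2) := Λ.image planeProj with hΛ₂
  have hmem : ∀ y : Λ, planeProj (y : Site 3) ∈ Λ₂ := fun y => Finset.mem_image_of_mem _ y.2
  let τ : Λ → Λ₂ := fun y => ⟨planeProj (y : Site 3), hmem y⟩
  set J := inPlane (layeredXYCoupling β Jp Jz Λ) (layer a) with hJ
  set A : Finset Λ := univ.filter (fun x : Λ => layer x = layer a) with hA
  have memA : ∀ x : Λ, x ∈ A ↔ (x : Site 3) 2 = (a : Site 3) 2 := fun x => by simp [hA, layer]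
  have hJ0 : ∀ p, 0 ≤ J p := fun p => by
    simp only [hJ, inPlane]
    split_ifs
    · exact layeredXYCoupling_nonneg hβ hp hz Λ p
    · exact le_rfl
  have hJA : ∀ p, J p ≠ 0 → p.1 ∈ A ∧ p.2 ∈ A := by
    intro p hp'
    simp only [hJ, inPlane] at hp'
    split_ifs at hp' with h
    · exact ⟨(memA p.1).2 h.1, (memA p.2).2 h.2⟩
    · exact absurd rfl hp'
  have hτ : Set.InjOn τ A := by
    intro y hy z hz hyz
    have h : planeProj (y : Site 3) = planeProj (z : Site 3) := congrArg Subtype.val hyz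
    exact Subtype.ext (planeProj_injOn_layer (((memA y).1 hy).trans ((memA z).1 hz).symm) h)
  have hK0 : ∀ q : Λ₂ × Λ₂, 0 ≤ nnXYCoupling (β * Jp) 2 Λ₂ q := fun q =>
    mul_nonneg (by positivity) (nnCoupling_nonneg _ _)
  have hdom : ∀ y ∈ A, ∀ z ∈ A, J (y, z) ≤ nnXYCoupling (β * Jp) 2 Λ₂ (τ y, τ z) := by
    intro y hy z hz
    have hyz : (y : Site 3) 2 = (z : Site 3) 2 := ((memA y).1 hy).trans ((memA z).1 hz).symm
    have hy' : layer y = layer a := (memA y).1 hy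
    have hz' : layer z = layer a := (memA z).1 hz
    simp only [hJ, inPlane, if_pos (And.intro hy' hz'), layeredXYCoupling, nnXYCoupling, layeredCoupling,
      nnCoupling]
    rw [l1Norm_sub_eq_of_layer_eq hyz]
    have h2 : ((y : Site 3) - (z : Site 3)) 2 = 0 := by simp [hyz]
    simp only [h2, if_true]
    split_ifs <;> nlinarith
  calc ∑ x ∈ A, twoPoint J a x
      ≤ ∑ x ∈ A, twoPoint (nnXYCoupling (β * Jp) 2 Λ₂) (τ a) (τ x) :=
        Finset.sum_le_sum fun x hx =>
          twoPoint_le_of_injOn hJ0 hJA τ hτ hK0 hdom ((memA a).2 rfl) hx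
    _ = ∑ u ∈ A.image τ, twoPoint (nnXYCoupling (β * Jp) 2 Λ₂) (τ a) u := by
        rw [Finset.sum_image fun y hy z hz hyz => hτ hy hz hyz]
    _ ≤ ∑ u : Λ₂, twoPoint (nnXYCoupling (β * Jp) 2 Λ₂) (τ a) u :=
        Finset.sum_le_sum_of_subset_of_nonneg (Finset.subset_univ _) fun u _ _ => twoPoint_nonneg hK0 _ _
    _ ≤ boxSusceptibilityBound R (nnBoxShellSum (β * Jp) 2 R) :=
        sum_twoPoint_nn_le_boxSusceptibilityBound (mul_nonneg hβ hp) hR hS Λ₂ (τ a)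

/-- **Layer decoupling with a computable input** (cell `pub/hubbard-tc`, INTERLAYER L3 ∘ K5-Lieb-box). For
`β, J∥, J⊥ ≥ 0`, a box radius `R ≥ 1` with Lieb's two-dimensional number `S_R(βJ∥) = nnBoxShellSum (βJ∥) 2 R < 1`,
every finite `Λ ⊂ ℤ³` and `a, c ∈ Λ`:

  `⟨cos(θ_a − θ_c)⟩_{Λ,β} ≤ (β J⊥ · X_R(S_R(βJ∥)))^{|ℓ(a) − ℓ(c)|}`,

`X_R = boxSusceptibilityBound R`. So the layered classical XY model decays exponentially across the layers, in
every volume, at temperature `T` as soon as `S_R(J∥/T) < 1` and `J⊥ X_R(S_R(J∥/T)) < T`: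
`k_B T_c^{3D-XY}(J∥, J⊥) ≤ T` — the quasi-2D crossover bound with the single-layer susceptibility replaced by a
certifiable finite-dimensional integral (mod-1's `twoPoint_layered_le_pow_interlayer'` with
`χ = X_R(S_R)`). Classical effective model only (K5).
[cite: Lieb1980, eq. (23) and p. 128 (boxes); Simon1980CMP, Thm 1.3; LiuStanley1972, p. 272 (layers (J, J, εJ))] -/
theorem twoPoint_layered_le_pow_interlayer_box {β Jp Jz : ℝ} (hβ : 0 ≤ β) (hp : 0 ≤ Jp) (hz : 0 ≤ Jz)
    {R : ℕ} (hR : 1 ≤ R) (hS : nnBoxShellSum (β * Jp) 2 R < 1) (Λ : Finset (Site 3)) (a c : Λ) :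
    twoPoint (layeredXYCoupling β Jp Jz Λ) a c ≤
      (β * Jz * boxSusceptibilityBound R (nnBoxShellSum (β * Jp) 2 R)) ^ (layer a - layer c).natAbs :=
  twoPoint_layered_le_pow_interlayer' hβ hp hz Λ
    (fun a' => sum_twoPoint_inPlane_le_boxSusceptibilityBound hβ hp hz hR hS Λ a') a c

end Layers

end PlaneRotator

end Literature.Probability.LatticeModels

end
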